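import Mathlib
import HarnessLib
import Summits.AtomisticToContinuum.BoseEinsteinCondensation.Theses.BECPhaseQuadratureSumRule

/-!
# Birth skeleton — crux `CondensateNumberConcentration`
(route `BECPhaseQuadratureSumRule`, item `stmt-AtomisticToContinuum-12616`, `Lines/birth.lean`)

LINE = the route's own foreseen split (TWO-LAYER PLAN: `ZeroModeFSum → ZeroMomentumSectorGap →
CondensateNumberConcentration`, glue `Var ≤ m₁/Δ`), typed in first quantisation over the tree's
cell vocabulary.  The lever is the FLUCTUATION VECTOR `Φ := (N̂₀ − n₀)Ψ` of the torus minimiser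
`Ψ = Ψ_t` (`N̂₀ = Σⱼ Pⱼ`, `Pⱼ` = cell average in particle `j`, `n₀ = ⟨Ψ, N̂₀Ψ⟩ =
condensateOccupation`): `‖Φ‖² = Var N̂₀`, `Φ ⊥ Ψ`, and the excitation form
`q(Φ) = E_w[Φ] − E₀(w)‖Φ‖²` (non-negative by the variational principle for unnormalised functions,
`periodicGroundStateEnergy_mul_lintegral_le`, since `Φ` is again `C¹`, periodic and Bose-symmetric)
is squeezed between a gap-type lower bound and the zero-mode f-sum (double-commutator) upper bound.

* `stub_zeroModeFSum` (size L; provable in print): `q(Φ) = ½⟨Ψ,[N̂₀,[H_t,N̂₀]]Ψ⟩ =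
  ½ t Σ_{i<j} ⟨[Pᵢ+Pⱼ,[vᵢⱼ,Pᵢ+Pⱼ]]⟩ ≤ C_v ρ N` uniformly in `t ∈ (0,1]`: the kinetic form commutes
  with `N̂₀`; `⟨PᵢΨ, vᵢⱼPᵢΨ⟩ = ‖v‖₁L⁻³⟨Pᵢ⟩`, `⟨PᵢPⱼΨ, vᵢⱼPᵢPⱼΨ⟩ = ‖v‖₁L⁻³⟨PᵢPⱼ⟩` and Cauchy–Schwarz
  against `t⟨V⟩_Ψ ≤ E₀(tv) ≤ E₀(v) ≤ 8πaρN` (LSSY2005 Thm 2.2, tree: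
  `LSSY2005_upperBound_periodic_holds`) give `C_v = O(‖v‖₁ + √(‖v‖₁a))`; the identity
  `q(AΨ) = ½⟨[A,[H,A]]⟩` for the `C¹` variational minimiser is the tree's weak Euler–Lagrange
  equation `PeriodicTrialState.firstVariation_eq` with `η = A²Ψ`.  Leans on: GiorginiPitaevskii
  Stringari1998 (Bogoliubov value `m₁ ≍ ρN a²/R₀`), Stringari1995 §2.3 (moment method).
* `stub_fluctuationGap` (size XL; the crux's declared risk, isolated and nothing else): in the ONE
  direction `Φ` the minimiser has an excitation gap `≫ 1/L³`, uniformly along the coupling path: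
  for every `ω`, eventually `q(Φ) ≥ (ω/L³)‖Φ‖²`.  Bogoliubov: `Φ` is a superposition of `P = 0`
  two-phonon states `b_k†b_{-k}†|0⟩` with weights `u_kv_k`, so `q(Φ)/‖Φ‖² ≍ (ρa²/R₀)/√(ρa³)` is a
  density-only constant and never below the free `2(2π/L)²`; failure = a near-degenerate
  uncondensed branch (avoided crossing in `t` at finite `N`), i.e. literally the crux's
  `why it might fail`; `¬stub_fluctuationGap` with `Var N̂₀ ≳ N²` is the route's KILL CRITERION.
* `stub_varianceIdentity` (size M; projection calculus: Fubini on `cell × cellN`, Bose symmetry,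
  `Pⱼ² = Pⱼ = Pⱼ†`, `[Pᵢ,Pⱼ] = 0`): `‖Φ‖² + n₀² = Σ_{i≠j}⟨PᵢPⱼ⟩ + n₀`, the right-hand side being
  literally the crux's `N(N−1)L⁻⁶∫|∫∫Ψ|² + condensateOccupation`.

GLUE (`CondensateNumberConcentration_of`, sorry-free, pure `ℝ≥0∞`/filter bookkeeping):
`(ω/L³)‖Φ‖² ≤ q(Φ) ≤ CρN`, so `‖Φ‖² ≤ CρN·L³/ω = CN²/ω ≤ ζN²` for `ω := (max C 0 + 1)/ζ`
(`ρL³ = N` is `div_sideLength_pow_three`), and the identity turns `‖Φ‖² ≤ ζN²` into the crux.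
No stub mentions the crux's conclusion; A and B speak about `q(Φ)`, C is an identity.

LAYOUT (the tree's skeleton device, cf. `Cruxes/GDTransfer/Lines/seeded_continuity.lean`): §1 the three
statements as `def … : Prop`; §2 the REGISTERED sorried stubs `theorem stub_<name> : <statement verbatim>
:= by sorry` and the name-keyed aliases `__Registered.stub_<name>` of the statements (the skeleton audit
admits a hypothesis iff its head constant is a tagged obligation or is NAMED like a declared stub; seats
cannot apply `@[stub]`); §3 the sorry-free composition `CondensateNumberConcentration_of` taking exactly the
three aliases and concluding the crux BY NAME, plus the sanity `example` feeding it the three stubs.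
-/

namespace Summit.AtomisticToContinuum.BoseEinsteinCondensation.Cruxes.CondensateNumberConcentration.Birth

open scoped ENNReal
open MeasureTheory Filter
open Literature.MathematicalPhysics.QuantumManyBody.BoseGas

noncomputable section

/-- `(N̂₀Ψ)(X) = Σⱼ L⁻³ ∫_cell Ψ(x₁,…,xⱼ₋₁,y,xⱼ₊₁,…,x_N) dy`: the zero-mode number operator
`N̂₀ = Σⱼ Pⱼ` (cell average in particle `j`) acting in first quantisation. -/
def zeroModeNumber (N : ℕ) (L : ℝ) (Ψ : Config N → ℂ) (X : Config N) : ℂ :=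
  ∑ j : Fin N, (((L ^ 3)⁻¹ : ℝ) : ℂ) * ∫ y in cell L, Ψ (Function.update X j y)

/-- The fluctuation vector `Φ = (N̂₀ − n₀)Ψ` with `n₀ = condensateOccupation N L Ψ = ⟨Ψ, N̂₀Ψ⟩`. -/
def fluctuation (N : ℕ) (L : ℝ) (Ψ : Config N → ℂ) (X : Config N) : ℂ :=
  zeroModeNumber N L Ψ X - ((condensateOccupation N L Ψ).toReal : ℂ) * Ψ X

/-- `‖Φ‖²` on the fundamental cell (`= Var N̂₀` for a normalised Bose-symmetric `Ψ`). -/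
def fluctuationNormSq (N : ℕ) (L : ℝ) (Ψ : Config N → ℂ) : ℝ≥0∞ :=
  ∫⁻ X in cellN N L, (‖fluctuation N L Ψ X‖₊ : ℝ≥0∞) ^ 2

/-- The unnormalised periodic energy form `E_w[Φ] = ∫_cell (|∇Φ|² + Σ_{i<j} w^per(xᵢ−xⱼ)|Φ|²)` of
the fluctuation vector. -/
def fluctuationEnergy (N : ℕ) (L : ℝ) (w : ℝ → ℝ≥0∞) (Ψ : Config N → ℂ) : ℝ≥0∞ :=
  ∫⁻ X in cellN N L, kineticDensity (fluctuation N L Ψ) X +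
    periodicInteraction w L X * (‖fluctuation N L Ψ X‖₊ : ℝ≥0∞) ^ 2


/-! ## §1 The three statements of the line -/

/-- Statement A — ZERO-MODE F-SUM BOUND: for the torus minimiser `Ψ` of `−ΣΔ + tΣv^per` at density
`ρ < ρ₀(v)`, `N = n + 2` large, uniformly in `t ∈ (0,1]`: `E_w[Φ] ≤ E₀(w)‖Φ‖² + C(v)·ρ·N`
(`q(Φ) = ½⟨[N̂₀,[tV,N̂₀]]⟩ ≤ CρN`; additive form, no truncated subtraction). -/
def ZeroModeFSum : Prop :=
  ∀ v : ℝ → ℝ≥0∞, IsRepulsiveFiniteRange v → (∀ r, v r ≠ ⊤) →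
    ContDiff ℝ 2 (fun x : Space => (v ‖x‖).toReal) →
    (∃ Cₑ : ℝ, ∀ x : Space, ‖iteratedFDeriv ℝ 2 (fun x : Space => (v ‖x‖).toReal) x‖ ≤
      Cₑ * Real.sqrt ((v ‖x‖).toReal)) →
    ∃ C ρ₀ : ℝ, 0 < ρ₀ ∧ ∀ ρ : ℝ, 0 < ρ → ρ < ρ₀ → ∀ᶠ n : ℕ in Filter.atTop,
      ∀ t : ℝ, 0 < t → t ≤ 1 → ∀ Ψ : PeriodicTrialState (n + 2) (sideLength ρ (n + 2)),
        (let L : ℝ := sideLength ρ (n + 2)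
         let w : ℝ → ℝ≥0∞ := fun r => ENNReal.ofReal t * v r
         periodicEnergy w Ψ = periodicGroundStateEnergy w (n + 2) L → periodicEnergy w Ψ ≠ ⊤ →
         fluctuationEnergy (n + 2) L w Ψ.ψ ≤
           periodicGroundStateEnergy w (n + 2) L * fluctuationNormSq (n + 2) L Ψ.ψ +
             ENNReal.ofReal (C * ρ * ((n : ℝ) + 2)))

/-- Statement B — GAP IN THE FLUCTUATION DIRECTION: for every `ω > 0`, at density `ρ < ρ₀(v,ω)`,
`N = n + 2` large, uniformly in `t ∈ (0,1]`: `(ω/L³)‖Φ‖² ≤ E_w[Φ] − E₀(w)‖Φ‖²` for the torus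
minimiser (the subtraction is not junk: `E₀‖Φ‖² ≤ E_w[Φ]` by `periodicGroundStateEnergy_mul_lintegral_le`). -/
def FluctuationGap : Prop :=
  ∀ v : ℝ → ℝ≥0∞, IsRepulsiveFiniteRange v → (∀ r, v r ≠ ⊤) →
    ContDiff ℝ 2 (fun x : Space => (v ‖x‖).toReal) →
    (∃ Cₑ : ℝ, ∀ x : Space, ‖iteratedFDeriv ℝ 2 (fun x : Space => (v ‖x‖).toReal) x‖ ≤
      Cₑ * Real.sqrt ((v ‖x‖).toReal)) →
    ∀ ω : ℝ, 0 < ω → ∃ ρ₀ : ℝ, 0 < ρ₀ ∧ ∀ ρ : ℝ, 0 < ρ → ρ < ρ₀ → ∀ᶠ n : ℕ in Filter.atTop,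
      ∀ t : ℝ, 0 < t → t ≤ 1 → ∀ Ψ : PeriodicTrialState (n + 2) (sideLength ρ (n + 2)),
        (let L : ℝ := sideLength ρ (n + 2)
         let w : ℝ → ℝ≥0∞ := fun r => ENNReal.ofReal t * v r
         periodicEnergy w Ψ = periodicGroundStateEnergy w (n + 2) L → periodicEnergy w Ψ ≠ ⊤ →
         ENNReal.ofReal (ω / L ^ 3) * fluctuationNormSq (n + 2) L Ψ.ψ ≤
           fluctuationEnergy (n + 2) L w Ψ.ψ -
             periodicGroundStateEnergy w (n + 2) L * fluctuationNormSq (n + 2) L Ψ.ψ)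

/-- Statement C — VARIANCE IDENTITY (projection calculus): for every periodic trial state of `n + 2`
particles on a cell of side `L > 0`, `‖Φ‖² + n₀² = N(N−1)L⁻⁶∫_{cell^n}|∫∫Ψ(x,y,Y)dxdy|²dY + n₀`. -/
def VarianceIdentity : Prop :=
  ∀ (n : ℕ) (L : ℝ), 0 < L →
    ∀ Ψ : PeriodicTrialState (n + 2) L,
      fluctuationNormSq (n + 2) L Ψ.ψ + condensateOccupation (n + 2) L Ψ.ψ ^ 2 =
        ((n + 2 : ℕ) : ENNReal) * ((n + 1 : ℕ) : ENNReal) *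
            (∫⁻ Y in cellN n L, (‖∫ x in cell L, ∫ y in cell L,
              Ψ.ψ (Matrix.vecCons x (Matrix.vecCons y Y))‖₊ : ENNReal) ^ 2) /
              ENNReal.ofReal (L ^ 6) +
          condensateOccupation (n + 2) L Ψ.ψ

/-! ## §2 Registered stubs (sorried theorems, statements verbatim) and their name-keyed aliases -/

/-- stub A — ZERO-MODE F-SUM BOUND (size L, provable in print).  For the torus minimiser `Ψ` of
`−ΣΔ + tΣv^per` at density `ρ < ρ₀(v)`, `N = n + 2` large, uniformly in `t ∈ (0,1]`:
`q(Φ) = E_w[Φ] − E₀(w)‖Φ‖² ≤ C ρ N` with `C = C(v)` (`= ½⟨[N̂₀,[tV,N̂₀]]⟩`, the kinetic form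
commuting with `N̂₀`; `C = O(‖v‖₁ + √(‖v‖₁ a))` via `⟨PᵢΨ,vᵢⱼPᵢΨ⟩ = ‖v‖₁L⁻³⟨Pᵢ⟩`, Cauchy–Schwarz and
`t⟨V⟩ ≤ E₀(tv) ≤ 8πaρN`).  Stated additively (no truncated subtraction). -/
theorem stub_zeroModeFSum : ∀ v : ℝ → ℝ≥0∞, IsRepulsiveFiniteRange v → (∀ r, v r ≠ ⊤) →
    ContDiff ℝ 2 (fun x : Space => (v ‖x‖).toReal) →
    (∃ Cₑ : ℝ, ∀ x : Space, ‖iteratedFDeriv ℝ 2 (fun x : Space => (v ‖x‖).toReal) x‖ ≤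
      Cₑ * Real.sqrt ((v ‖x‖).toReal)) →
    ∃ C ρ₀ : ℝ, 0 < ρ₀ ∧ ∀ ρ : ℝ, 0 < ρ → ρ < ρ₀ → ∀ᶠ n : ℕ in Filter.atTop,
      ∀ t : ℝ, 0 < t → t ≤ 1 → ∀ Ψ : PeriodicTrialState (n + 2) (sideLength ρ (n + 2)),
        (let L : ℝ := sideLength ρ (n + 2)
         let w : ℝ → ℝ≥0∞ := fun r => ENNReal.ofReal t * v r
         periodicEnergy w Ψ = periodicGroundStateEnergy w (n + 2) L → periodicEnergy w Ψ ≠ ⊤ →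
         fluctuationEnergy (n + 2) L w Ψ.ψ ≤
           periodicGroundStateEnergy w (n + 2) L * fluctuationNormSq (n + 2) L Ψ.ψ +
             ENNReal.ofReal (C * ρ * ((n : ℝ) + 2))) := by
  sorry

/-- stub B — GAP IN THE FLUCTUATION DIRECTION (size XL; the crux's risk).  For every `ω > 0`, at
density `ρ < ρ₀(v, ω)`, `N = n + 2` large, uniformly in `t ∈ (0,1]`, the torus minimiser `Ψ`
satisfies `(ω/L³)‖Φ‖² ≤ q(Φ) = E_w[Φ] − E₀(w)‖Φ‖²` (`Φ ⊥ Ψ`; Bogoliubov: `q(Φ)/‖Φ‖²` is a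
density-only constant `≫ (2π/L)² ≫ ω/L³`).  The subtraction is not junk: `E₀‖Φ‖² ≤ E_w[Φ]` by
`periodicGroundStateEnergy_mul_lintegral_le` (`Φ` is `C¹`, periodic, Bose-symmetric). -/
theorem stub_fluctuationGap : ∀ v : ℝ → ℝ≥0∞, IsRepulsiveFiniteRange v → (∀ r, v r ≠ ⊤) →
    ContDiff ℝ 2 (fun x : Space => (v ‖x‖).toReal) →
    (∃ Cₑ : ℝ, ∀ x : Space, ‖iteratedFDeriv ℝ 2 (fun x : Space => (v ‖x‖).toReal) x‖ ≤
      Cₑ * Real.sqrt ((v ‖x‖).toReal)) →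
    ∀ ω : ℝ, 0 < ω → ∃ ρ₀ : ℝ, 0 < ρ₀ ∧ ∀ ρ : ℝ, 0 < ρ → ρ < ρ₀ → ∀ᶠ n : ℕ in Filter.atTop,
      ∀ t : ℝ, 0 < t → t ≤ 1 → ∀ Ψ : PeriodicTrialState (n + 2) (sideLength ρ (n + 2)),
        (let L : ℝ := sideLength ρ (n + 2)
         let w : ℝ → ℝ≥0∞ := fun r => ENNReal.ofReal t * v r
         periodicEnergy w Ψ = periodicGroundStateEnergy w (n + 2) L → periodicEnergy w Ψ ≠ ⊤ →
         ENNReal.ofReal (ω / L ^ 3) * fluctuationNormSq (n + 2) L Ψ.ψ ≤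
           fluctuationEnergy (n + 2) L w Ψ.ψ -
             periodicGroundStateEnergy w (n + 2) L * fluctuationNormSq (n + 2) L Ψ.ψ) := by
  sorry

/-- stub C — VARIANCE IDENTITY (size M; projection calculus on the cell: Fubini, Bose symmetry,
`Pⱼ² = Pⱼ = Pⱼ†`, `[Pᵢ,Pⱼ] = 0`).  For every periodic trial state of `n + 2` particles,
`‖Φ‖² + n₀² = Σ_{i≠j}⟨Ψ,PᵢPⱼΨ⟩ + n₀ = N(N−1)L⁻⁶∫_{cell^n}|∫∫Ψ(x,y,Y)dxdy|²dY + n₀`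
(`‖N̂₀Ψ‖² = n₀ + Σ_{i≠j}⟨PᵢPⱼ⟩`, `⟨Ψ,N̂₀Ψ⟩ = n₀`, `‖Ψ‖² = 1`). -/
theorem stub_varianceIdentity : ∀ (n : ℕ) (L : ℝ), 0 < L →
    ∀ Ψ : PeriodicTrialState (n + 2) L,
      fluctuationNormSq (n + 2) L Ψ.ψ + condensateOccupation (n + 2) L Ψ.ψ ^ 2 =
        ((n + 2 : ℕ) : ENNReal) * ((n + 1 : ℕ) : ENNReal) *
            (∫⁻ Y in cellN n L, (‖∫ x in cell L, ∫ y in cell L,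
              Ψ.ψ (Matrix.vecCons x (Matrix.vecCons y Y))‖₊ : ENNReal) ^ 2) /
              ENNReal.ofReal (L ^ 6) +
          condensateOccupation (n + 2) L Ψ.ψ := by
  sorry

/-! ### Name-keyed aliases — the hypotheses of `CondensateNumberConcentration_of` (each `rfl`-equal to
its statement; the skeleton audit admits a hypothesis whose head constant is named like a declared stub). -/
namespace __Registered

/-- alias of `ZeroModeFSum` = the statement of `stub_zeroModeFSum`. -/
abbrev stub_zeroModeFSum : Prop := ZeroModeFSum

/-- alias of `FluctuationGap` = the statement of `stub_fluctuationGap`. -/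
abbrev stub_fluctuationGap : Prop := FluctuationGap

/-- alias of `VarianceIdentity` = the statement of `stub_varianceIdentity`. -/
abbrev stub_varianceIdentity : Prop := VarianceIdentity

end __Registered

/-! ## §3 Composition (sorry-free): the three registered statements give the crux BY NAME -/

/-- ASSEMBLY (sorry-free, pure `ℝ≥0∞`/filter bookkeeping): zero-mode f-sum bound → fluctuation gap →
variance identity → `CondensateNumberConcentration` (the route decl, by name). -/
theorem CondensateNumberConcentration_of (hA : __Registered.stub_zeroModeFSum)
    (hB : __Registered.stub_fluctuationGap) (hC : __Registered.stub_varianceIdentity) :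
    Summit.AtomisticToContinuum.BoseEinsteinCondensation.Theses.BECPhaseQuadratureSumRule.CondensateNumberConcentration := by
  dsimp only [__Registered.stub_zeroModeFSum, __Registered.stub_fluctuationGap,
    __Registered.stub_varianceIdentity, ZeroModeFSum, FluctuationGap, VarianceIdentity] at hA hB hC
  intro v hv hfin hC2 hedge ζ hζ
  obtain ⟨C, ρ₁, hρ₁, hA'⟩ := hA v hv hfin hC2 hedge
  -- the gap scale ω beating the f-sum constant
  have hM : 0 < max C 0 + 1 := by positivity
  set ω : ℝ := (max C 0 + 1) / ζ with hω_def
  have hω : 0 < ω := div_pos hM hζ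
  obtain ⟨ρ₂, hρ₂, hB'⟩ := hB v hv hfin hC2 hedge ω hω
  refine ⟨min ρ₁ ρ₂, lt_min hρ₁ hρ₂, ?_⟩
  intro ρ hρ hρlt
  filter_upwards [hA' ρ hρ (hρlt.trans_le (min_le_left _ _)),
    hB' ρ hρ (hρlt.trans_le (min_le_right _ _))] with n hAn hBn
  intro t ht ht1
  have h1 := hAn t ht ht1
  have h2 := hBn t ht ht1
  clear hAn hBn
  -- the two facts about L = (N/ρ)^{1/3} the glue needs: L > 0 and ρL³ = N
  have hL : 0 < sideLength ρ (n + 2) :=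
    Real.rpow_pos_of_pos (div_pos (Nat.cast_pos.mpr (by omega)) hρ) _
  have hρL : ρ * sideLength ρ (n + 2) ^ 3 = (n : ℝ) + 2 := by
    have h := div_sideLength_pow_three hρ (N := n + 2) (by omega)
    rw [div_eq_iff (pow_pos hL 3).ne'] at h
    push_cast at h
    linarith
  generalize sideLength ρ (n + 2) = L at h1 h2 hL hρL ⊢
  intro Ψ
  have h1Ψ := h1 Ψ
  have h2Ψ := h2 Ψ
  clear h1 h2
  dsimp only at h1Ψ h2Ψ ⊢
  intro hmin hfinE
  have hA1 := h1Ψ hmin hfinE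
  have hB1 := h2Ψ hmin hfinE
  -- squeeze: (ω/L³)·‖Φ‖² ≤ q(Φ) ≤ CρN
  have hsq : ENNReal.ofReal (ω / L ^ 3) * fluctuationNormSq (n + 2) L Ψ.ψ ≤
      ENNReal.ofReal (C * ρ * ((n : ℝ) + 2)) :=
    hB1.trans (tsub_le_iff_right.mpr (hA1.trans_eq (add_comm _ _)))
  have hωL : 0 < ω / L ^ 3 := div_pos hω (pow_pos hL 3)
  have hF : fluctuationNormSq (n + 2) L Ψ.ψ ≤
      ENNReal.ofReal (C * ρ * ((n : ℝ) + 2)) / ENNReal.ofReal (ω / L ^ 3) := by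
    rw [ENNReal.le_div_iff_mul_le (Or.inl (ENNReal.ofReal_pos.mpr hωL).ne')
      (Or.inl ENNReal.ofReal_ne_top), mul_comm]
    exact hsq
  -- arithmetic: CρN/(ω/L³) = CN²/ω ≤ ζN²
  have hkey : C * ρ * ((n : ℝ) + 2) / (ω / L ^ 3) ≤ ζ * ((n : ℝ) + 2) ^ 2 := by
    rw [div_div_eq_mul_div]
    have hrw : C * ρ * ((n : ℝ) + 2) * L ^ 3 = C * ((n : ℝ) + 2) ^ 2 := by
      calc C * ρ * ((n : ℝ) + 2) * L ^ 3 = C * ((n : ℝ) + 2) * (ρ * L ^ 3) := by ring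
        _ = C * ((n : ℝ) + 2) ^ 2 := by rw [hρL]; ring
    rw [hrw, div_le_iff₀ hω, hω_def]
    have hN2 : (0 : ℝ) ≤ ((n : ℝ) + 2) ^ 2 := by positivity
    calc C * ((n : ℝ) + 2) ^ 2 ≤ (max C 0 + 1) * ((n : ℝ) + 2) ^ 2 := by
          gcongr
          exact (le_max_left _ _).trans (le_add_of_nonneg_right zero_le_one)
      _ = ζ * ((n : ℝ) + 2) ^ 2 * ((max C 0 + 1) / ζ) := by
          field_simp
  have hF' : fluctuationNormSq (n + 2) L Ψ.ψ ≤ ENNReal.ofReal (ζ * ((n : ℝ) + 2) ^ 2) := by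
    refine hF.trans ?_
    rw [← ENNReal.ofReal_div_of_pos hωL]
    exact ENNReal.ofReal_le_ofReal hkey
  -- the identity turns ‖Φ‖² ≤ ζN² into the crux
  rw [← hC n L hL Ψ]
  exact (add_comm _ _).trans_le (add_le_add le_rfl hF')


/-- Sanity (not a declaration): the registered stubs' statements are literally the hypotheses of
`CondensateNumberConcentration_of`, so this term closes the crux the day the three stubs are theorems. -/
example : Summit.AtomisticToContinuum.BoseEinsteinCondensation.Theses.BECPhaseQuadratureSumRule.CondensateNumberConcentration :=
  CondensateNumberConcentration_of stub_zeroModeFSum stub_fluctuationGap stub_varianceIdentity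

end

end Summit.AtomisticToContinuum.BoseEinsteinCondensation.Cruxes.CondensateNumberConcentration.Birth
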